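import Literature.MathematicalPhysics.QuantumFieldTheory.Balaban1983to89.Beta.RemainderOriginTowerDivPlaquette
import Literature.MathematicalPhysics.QuantumFieldTheory.Balaban1983to89.Beta.RemainderTowerDisplayIrrel

/-!
# T. Bałaban, *The variational problem and background fields …*, Commun. Math. Phys. **102** (1985) 277–309 [Balaban1985Variational] (182) p. 307, (190)
# p. 308, (129) p. 297, with [Balaban1985BackgroundPropagators] (3.3), (3.8) pp. 391–392, (3.35)–(3.37) p. 396, Thm 3.3 (3.42) pp. 397–399 (value AND
# covariant-derivative lines), Thm 3.11 p. 416, (3.126) p. 420, (3.132)–(3.133) p. 422, (3.137) p. 423: **THE DIVERGENCE LINE OF NODE D OF ROW (D4)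
# AT THE ORIGIN ON PRINT's SMALL-FIELD CLASS — THE CONSUMER's FORM: «Y12d» READ AT ANY ADMISSIBLE REGULARITY DISPLAY, ONTO-THRESHOLD AND POSITIVITY
# WITNESS THE CONSUMER HOLDS** (through «Y12c» `Beta.RemainderTowerDisplayIrrel`)

CITATION HEADER (lean-in-tree rule 2026-08-18).  Sources and loci exactly as in «Y12a» `Beta.RemainderHasMajH1kTowerPlaquette` ∕ «Y12b»
`Beta.RemainderOriginTowerPlaquette` (this lineage, gen 112): [Balaban1985Variational] (B11 = [15]; held `paper:balaban1985-cmp102-variational-background`,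
journal page = PDF page + 276) (129) p. 297, (180) p. 306, (182) p. 307, (190) p. 308; [Balaban1985BackgroundPropagators] (B9 = [5];
`paper:balaban1985-cmp99-background-propagators`, journal page = PDF page + 388) (3.15)–(3.16) p. 393, (3.26) p. 395, (3.35)–(3.37) p. 396, Thm 3.1 (3.42)
p. 397, Thm 3.3 p. 399, Thm 3.11 p. 416, (3.126) p. 420, (3.132)–(3.133) p. 422, (3.137) p. 423; [Balaban1985Averaging] (B7 = [4]) Prop. 2 (52)–(54) p. 26,
(122) p. 36, (18) p. 21; [Balaban1984PropagatorsII] (B6) (2.51)–(2.52) p. 232, (2.54) p. 233, Lemma 2.1 (2.61) p. 234.  Nothing of print is asserted here.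

WHY THIS FILE (audit cell `pub-balaban`, BINDER row (D4), OWNER lineage `b2b-balaban-beta-an4`, gen 112; «Y12g»).  As «Y12f» for the value line: «Y12d»
`exists_ineq190_div_origin_tower_plaquette` concludes `∃ αU hα1 hαL hU1 hreg hpos, …`; THIS FILE re-reads it with the display ∕ threshold ∕ witness
UNIVERSALLY quantified (the consumer's terms), by «Y12c»'s display ∕ witness irrelevance:
* **`exists_ineq190_div_origin_tower_plaquette_anyDisplay`** — the divergence line's END on print's class for EVERY admissible `(αU, hα1, hαL, hU1, hreg, hpos)`.
Mechanism: one `obtain` + `rw [H1k_display_irrel, laplaceAk_display_irrel, QkW_display_irrel]`.  (The slice-gradient twin: «Y12h»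
`Beta.RemainderOriginTowerSliceGradPlaquetteAnyDisplay`.)

HONEST SCOPE.  [folklore] bookkeeping: one `obtain` + three `rw` per theorem («Y12c»'s display ∕ witness irrelevance); NO estimate of [5], [15] or [4]
is proved here; what stays displayed is exactly as in «Y12b» (print's three windows read GLOBALLY on the torus, the weights `ρ_w`, the Hilbert-structure
letters, `Δ⁽²⁾`'s (3.137) majorant — NODE-O-class identification NOT done —, the two smallnesses in `λ`).  Nothing identifies Bałaban's step-`k` objects
(NODE O ∕ A FROZEN (0)).  Row (D4) class UNCHANGED (instance 0∕1; D4 DISCHARGE NO DATE); NOT B12 Thm 2, NOT BetaPertH, NOT continuum, NOT Clay.  HONEST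
DEPENDENCY (cell line): continuum YM on T⁴ ⇐ BetaPertH ∧ nine spine estimates (0/9 proved); BetaPertH ⇐ (D1) ∧ (D4) ∧ CAP+tail; G-an2-4 gates asym, D1 and
NE2/3/4.  NEW file; nothing modified; 0 `def`; standard axioms; no `sorry`; `maxHeartbeats` ×2 on the one theorem (the sixty-binder statement, as «Y7»).
Net new unproved facts: 0.
-/

noncomputable section

open scoped BigOperators InnerProductSpace ComplexConjugate

namespace Literature.MathematicalPhysics.QuantumFieldTheory.Balaban1983to89.Beta.RemainderOriginTowerDivPlaquetteAnyDisplay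

open B11SectG B11SupSize190
open B4Sect5Torus (TSite tdist tdist_nonneg)
open B4Sect5Proof (latticeConst)
open B5TorusCover (UT)
open B9Thm34Ext (toB6)
open B9Thm37GlueTorus (torusGeom tdist1)
open B9SectCLatticeCarrier (Bond bpos btgt unshift)
open B9Eq311L2Pairing (WL2)
open B9Eq319QprimeTorus (blockCoord)
open B9Eq315QTower (towerP UlevOf)
open B9Eq315QTorus (perCfg perCfg_apply cornerSite)
open B9Eq316TowerFlatIsOneStep (siteCast towerP_eq_fineP_pow)
open B7Prop1Explicit (U1 Wcx boxVec)
open B7Prop2Explicit (pdev AvgClosed C0 c2' C0_pos c2'_pos unitaryUnits avgClosed_unitaryUnits unitaryUnits_le_U1)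
open B7Eq43AveragedSmallnessLevelFree (UlevOf_mem pdev_perCfg_le_of_plaq exists_profile_of_windows_eta)
open B11Eq44COperatorTower (αT αT_le ulev_mem_U1_of_pdev ulev_reg_of_pdev)
open B9Eq315QTowerRegularityDisplay (profile_le_αT)
open B9Eq315QTowerRegularityProfile (ulev_reg_geometric)
open B9Eq310DeltaPrime (plaqHolU)
open B9Eq310HessianOperator (adTransportW)
open B9Eq310HessianHermitian (adTransportW_adjoint)
open B11Eq103H1Complex (SiteL2K BondL2K KinvLatticeK covDerivL2K covDivL2K)
open B9Eq326OperatorTower (laplaceAk QkW G1k H1k)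
open B9Eq324DeltaPrimeATower (laplacePrimeAk)
open B9Eq342GreenPrimeSupBound (norm_adTransportW_eq)
open B9Eq326OperatorTowerRealityUnitary (star_val_eq_inv_of_mem_unitaryUnits forall_star_eq_inv_of_mem)
open B9Thm311LaplaceAkPositiveDiagonal (exists_laplaceAk_pos_diagonal_closed)
open B9Thm311SitePrimeFormCoerciveTowerCanonical (exists_strong_site_coercive_tower_diagonal)
open Beta.RemainderOriginTowerDivPlaquette (exists_ineq190_div_origin_tower_plaquette)
open Beta.RemainderTowerDisplayIrrel (QkW_display_irrel laplaceAk_display_irrel H1k_display_irrel)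

/-! ## The divergence line at ANY display ∕ witness -/

section Tower

variable {d : ℕ} (hd : 1 ≤ d) (L : ℕ) [NeZero L] (hL : 1 ≤ L) (hL3 : 3 ≤ L)
  {𝔸 : Type*} [CStarAlgebra 𝔸] [Nontrivial 𝔸]
  {W : Type} [NormedAddCommGroup W] [InnerProductSpace ℂ W] [FiniteDimensional ℂ W] (φ : W ≃ₗ[ℂ] 𝔸)
  {Mφ Mφ' : ℝ} (hMφ : 0 ≤ Mφ) (hMφ' : 0 ≤ Mφ') (hφ : ∀ w, ‖φ w‖ ≤ Mφ * ‖w‖) (hφ' : ∀ X, ‖φ.symm X‖ ≤ Mφ' * ‖X‖)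
  {a : ℝ} (ha : 0 < a) {a' : ℝ} (ha' : 0 < a')
  (τ : 𝔸 →ₗ[ℂ] ℂ) {Cτ : ℝ} (hτ : ∀ X, ‖τ X‖ ≤ Cτ * ‖X‖) (hCτ : 0 ≤ Cτ) {Mτ : ℝ} (hτm : ∀ X Y : 𝔸, ‖τ (X * Y)‖ ≤ Mτ * ‖X‖ * ‖Y‖) (hMτ : 0 ≤ Mτ)
  {ρw : ℝ} (hρw : 0 ≤ ρw)
  (hτ₁ : ∀ X : 𝔸, τ (star X) = conj (τ X)) (hτ₂ : ∀ X Y : 𝔸, τ (X * Y) = τ (Y * X)) (hφτ : ∀ X Y : 𝔸, ⟪φ.symm X, φ.symm Y⟫_ℂ = τ (star X * Y))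
  (AQ : ℝ) (hAQ16 : 16 * ((d : ℝ) + 1) * ((d : ℝ) + 4) * c2' d L ≤ AQ)

set_option maxHeartbeats 400000 in
include hd hL hL3 hMφ hMφ' hφ hφ' ha ha' hτ hCτ hτm hMτ hρw hτ₁ hτ₂ hφτ hAQ16 in
/-- **THE DIVERGENCE LINE OF NODE D AT THE ORIGIN ON PRINT's CLASS — THE END AT ANY ADMISSIBLE DISPLAY ∕ WITNESS** («Y12d» `exists_ineq190_div_origin_tower_plaquette` read
through «Y12c» `H1k_display_irrel` ∕ `laplaceAk_display_irrel` ∕ `QkW_display_irrel`): `∃ (α⋆, B, δ₀, B_E, A′, r₁)` first; under the `∀` the diagonal, weights, period,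
a `unitaryUnits`-valued `U` in the three-window class (`α ≤ α⋆`), THE CONSUMER's display `(αU, hα1, hαL, hU1, hreg)` and witness `hpos`, geometry, rates,
`Δ⁽²⁾`'s displayed (3.137) majorant, the derived constants (`rfl`) and the two smallnesses in `λ`; CONCLUSION: `G′ = (Δ_{a,k}(U) − Δ⁽²⁾)⁻¹`, `(Q_kG′Q_k†)⁻¹`
CONSTRUCTED two-sided and `∀ δ″, δ″∕8 ≤ ρ → Ineq190 S^{coarse}_m S^{fine sites}_m (D*_Uᵉ ∘ (H₀ + G̃Δ⁽²⁾H₀)) (A₀ᴱ + B_G̃ᴱθ_Dc) δ″`, with `Δ_{a,k}(U) = laplaceAk … αU …`,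
`Q_k = QkW … αU …`, `H₀ = (H1k … αU … hαL hpos)ᵉ↾ℝ` THE CONSUMER's TERMS ([15] (182): `(δ/δB)𝓗(0) = H₀ + G̃Δ⁽²⁾H₀`; (190) at the origin).
[cite: Balaban1985Variational, (182) p.307, (190) p.308, (129)–(131) pp.297–298, (180) p.306] [cite: Balaban1985BackgroundPropagators, Thm 3.1 (3.42) p.397, Thm 3.3 p.399, (3.8) p.392,
Thm 3.11 p.416, (3.35)–(3.37) p.396, (3.15) p.393, (3.26) p.395, (3.126) p.420, (3.132)–(3.133) p.422, (3.137)–(3.138) p.423] [cite: Balaban1985Averaging, Prop. 2 (52)–(54) p.26, (122) p.36]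
[cite: Balaban1984PropagatorsII, (2.51)–(2.52) p.232, (2.54) p.233, Lemma 2.1 (2.61) p.234] -/
theorem exists_ineq190_div_origin_tower_plaquette_anyDisplay :
    ∃ αs B δ BE A' r₁ : ℝ, 0 < αs ∧ 0 ≤ B ∧ 0 < δ ∧ 0 ≤ BE ∧ 0 ≤ A' ∧ 0 < r₁ ∧
      ∀ (n : ℕ) (η : ℝ) (_hηL : η * (L : ℝ) ^ (n + 1) = 1) (c₀ c₁ : ℝ) [Fact (0 < c₀)] [Fact (0 < c₁)]
        (_hw : c₀ * ((L : ℝ) ^ (n + 1)) ^ d = c₁) (_hρ : |η| ^ d / c₀ ≤ ρw) (m : Fin d → ℕ) [∀ i, NeZero (m i)] (_hm : ∀ i, 1 ≤ m i)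
        (U : Bond d (towerP L m (n + 1)) → 𝔸ˣ) (_hUu : ∀ b, U b ∈ unitaryUnits 𝔸)
        (α : ℝ) (_hα : 0 ≤ α) (_hαle : α ≤ αs) (_hUη : ∀ b, ‖(U b : 𝔸) - 1‖ ≤ α * η)
        (_hpl : ∀ p : B9SectCLatticeCarrier.Plaq d (towerP L m (n + 1)), ‖(plaqHolU U p : 𝔸) - 1‖ ≤ α * η ^ 2)
        (_hUgrad : ∀ (x : TSite d (towerP L m (n + 1))) (μ : Fin d), ‖(U (x, μ) : 𝔸) - U (unshift μ x, μ)‖ ≤ α * η ^ 2)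
        -- the consumer's OWN regularity display, onto-threshold and positivity witness (ANY admissible ones):
        (αU : ℕ → ℝ) (hα1 : ∀ j, αU j ≤ 1 / 64) (hαL : ∀ j, 50 * (d + 1) * αU j * (L : ℝ) ^ d ≤ 1 / 2)
        (hU1 : ∀ (j : ℕ) (x : B7Prop1Explicit.Site d) (k : Fin d), perCfg (towerP L m (j + 1)) (UlevOf L m (n + 1) U j) x k ∈ U1 𝔸)
        (hreg : ∀ (j : ℕ) (y : TSite d (towerP L m j)) (k : Fin d) (ρ' : Fin d → Fin L),
          ‖((Wcx L (perCfg (towerP L m (j + 1)) (UlevOf L m (n + 1) U j)) (cornerSite L y) k (boxVec L ρ') : 𝔸ˣ) : 𝔸) - 1‖ ≤ αU j)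
        (hpos : ∀ x : BondL2K ℂ d (towerP L m (n + 1)) c₀ W, x ≠ 0 →
          0 < RCLike.re ⟪x, laplaceAk L m n φ η U hL αU hα1 hU1 hreg τ (c₀ := c₀) (c₁ := c₁) a x⟫_ℂ)
        (η₀ L₀ M₀ R : ℝ) (H : Prop)
        -- the rates and the (free) row-sum constant
        (ρ σ c : ℝ) (_hσ : 0 < σ) (_hρ0 : 0 ≤ ρ) (_hρ₁ : ρ + 5 * σ ≤ δ / d) (_hρI : ρ + 5 * σ ≤ r₁ / d) (_hc_def : c = B6.c0 1 σ ^ d)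
    -- `Δ⁽²⁾` DISPLAYED: a local operator on the fine carrier ((3.137): range `r_D`, row and column sums `≤ λ`)
    (D2 : BondL2K ℂ d (towerP L m (n + 1)) c₀ W →ₗ[ℂ] BondL2K ℂ d (towerP L m (n + 1)) c₀ W)
    {KD : UT m → UT m → ℝ} {lam rD : ℝ} (hlam : 0 ≤ lam) (hKD : ∀ y v, 0 ≤ KD y v)
    (hDloc : ∀ y v, KD y v ≠ 0 → (toB6 (torusGeom m η₀ L₀ M₀) R H).dist y v ≤ rD)
    (hDrow : ∀ y, ∑ v : UT m, KD y v ≤ lam) (hDcol : ∀ v, ∑ y : UT m, KD y v ≤ lam)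
    (hD2 : HasMaj
      (supSize (toB6 (torusGeom m η₀ L₀ M₀) R H)
        (fun y => Finset.univ.filter fun b : Bond d (towerP L m (n + 1)) =>
          blockCoord (L ^ (n + 1)) m (siteCast (towerP_eq_fineP_pow L m (n + 1)) (bpos b)) = UT.toSite m y)
        (fun b => UT.ofSite m (blockCoord (L ^ (n + 1)) m (siteCast (towerP_eq_fineP_pow L m (n + 1)) (bpos b)))) :
          BlockNorm (toB6 (torusGeom m η₀ L₀ M₀) R H) (Bond d (towerP L m (n + 1)) → W))
      (supSize (toB6 (torusGeom m η₀ L₀ M₀) R H)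
        (fun y => Finset.univ.filter fun b : Bond d (towerP L m (n + 1)) =>
          blockCoord (L ^ (n + 1)) m (siteCast (towerP_eq_fineP_pow L m (n + 1)) (bpos b)) = UT.toSite m y)
        (fun b => UT.ofSite m (blockCoord (L ^ (n + 1)) m (siteCast (towerP_eq_fineP_pow L m (n + 1)) (bpos b)))))
      (((WL2.linearEquiv ℂ ℂ (fun _ : Bond d (towerP L m (n + 1)) => c₀) :
            BondL2K ℂ d (towerP L m (n + 1)) c₀ W ≃ₗ[ℂ] (Bond d (towerP L m (n + 1)) → W)).toLinearMap ∘ₗ D2 ∘ₗ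
          (WL2.linearEquiv ℂ ℂ (fun _ : Bond d (towerP L m (n + 1)) => c₀) :
            BondL2K ℂ d (towerP L m (n + 1)) c₀ W ≃ₗ[ℂ] (Bond d (towerP L m (n + 1)) → W)).symm.toLinearMap).restrictScalars ℝ)
      KD)
    -- the derived constants, bound to their closed forms (instantiate with `rfl`), and the TWO smallnesses in `λ`
    {q BG' θP qI BI' A₀ θD A₀E BEG' BEt : ℝ}
    (hq_def : q = B * lam * Real.exp (δ / d * rD) * c) (hq : q < 1) (hBG' : BG' = B * (1 - q)⁻¹)
    (hθP : θP = B * lam * Real.exp (δ / d * rD) * BG' * c *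
      ((Mφ' * Real.exp (100 * d * (d + 1) * (L : ℝ) ^ d * AQ) * Mφ * ((2 * d : ℕ) : ℝ)) * Real.exp 1 * latticeConst d 1) *
      Real.exp ((ρ + 4 * σ) * d) * ((Mφ' * Mφ * Real.exp (50 * (d + 1) * AQ)) * Real.exp 1 * latticeConst d 1) *
      Real.exp ((ρ + 4 * σ) * d))
    (hqI : qI = A' * θP * c * c) (hqI1 : qI < 1) (hBI' : BI' = A' * (1 - qI)⁻¹)
    (hA₀ : A₀ = B * ((Mφ' * Real.exp (100 * d * (d + 1) * (L : ℝ) ^ d * AQ) * Mφ * ((2 * d : ℕ) : ℝ)) * Real.exp 1 *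
      latticeConst d 1) * Real.exp δ * A' * c)
    (hθD : θD = A₀ * lam * Real.exp (ρ * rD))
    (hA₀E : A₀E = BE * ((Mφ' * Real.exp (100 * d * (d + 1) * (L : ℝ) ^ d * AQ) * Mφ * ((2 * d : ℕ) : ℝ)) * Real.exp 1 * latticeConst d 1) * Real.exp δ * A' * c)
    (hBEG' : BEG' = BE + BE * lam * Real.exp (δ / d * rD) * BG' * c)
    (hBEt : BEt = BEG' + ((Mφ' * Mφ * Real.exp (50 * (d + 1) * AQ)) * Real.exp 1 * latticeConst d 1) *
      ((Mφ' * Real.exp (100 * d * (d + 1) * (L : ℝ) ^ d * AQ) * Mφ * ((2 * d : ℕ) : ℝ)) * Real.exp 1 * latticeConst d 1) *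
      BI' * BEG' * BG' * Real.exp ((ρ + 2 * σ) * d) * Real.exp ((ρ + 2 * σ) * d) * c * c),
    ∃ (G' : (Bond d (towerP L m (n + 1)) → W) →L[ℂ] (Bond d (towerP L m (n + 1)) → W))
      (Inv' : (Bond d m → W) →L[ℂ] (Bond d m → W)),
      -- `G′ = (Δ_{a,k}(U) − Δ⁽²⁾)⁻¹`, two-sided
      G' * (LinearMap.toContinuousLinearMap
          ((WL2.linearEquiv ℂ ℂ (fun _ : Bond d (towerP L m (n + 1)) => c₀) :
              BondL2K ℂ d (towerP L m (n + 1)) c₀ W ≃ₗ[ℂ] (Bond d (towerP L m (n + 1)) → W)).toLinearMap ∘ₗ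
            laplaceAk L m n φ η U hL αU hα1 hU1 hreg τ (c₀ := c₀) (c₁ := c₁) a ∘ₗ
            (WL2.linearEquiv ℂ ℂ (fun _ : Bond d (towerP L m (n + 1)) => c₀) :
              BondL2K ℂ d (towerP L m (n + 1)) c₀ W ≃ₗ[ℂ] (Bond d (towerP L m (n + 1)) → W)).symm.toLinearMap) -
        LinearMap.toContinuousLinearMap
          ((WL2.linearEquiv ℂ ℂ (fun _ : Bond d (towerP L m (n + 1)) => c₀) :
              BondL2K ℂ d (towerP L m (n + 1)) c₀ W ≃ₗ[ℂ] (Bond d (towerP L m (n + 1)) → W)).toLinearMap ∘ₗ D2 ∘ₗ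
            (WL2.linearEquiv ℂ ℂ (fun _ : Bond d (towerP L m (n + 1)) => c₀) :
              BondL2K ℂ d (towerP L m (n + 1)) c₀ W ≃ₗ[ℂ] (Bond d (towerP L m (n + 1)) → W)).symm.toLinearMap)) = 1 ∧
      (LinearMap.toContinuousLinearMap
          ((WL2.linearEquiv ℂ ℂ (fun _ : Bond d (towerP L m (n + 1)) => c₀) :
              BondL2K ℂ d (towerP L m (n + 1)) c₀ W ≃ₗ[ℂ] (Bond d (towerP L m (n + 1)) → W)).toLinearMap ∘ₗ
            laplaceAk L m n φ η U hL αU hα1 hU1 hreg τ (c₀ := c₀) (c₁ := c₁) a ∘ₗ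
            (WL2.linearEquiv ℂ ℂ (fun _ : Bond d (towerP L m (n + 1)) => c₀) :
              BondL2K ℂ d (towerP L m (n + 1)) c₀ W ≃ₗ[ℂ] (Bond d (towerP L m (n + 1)) → W)).symm.toLinearMap) -
        LinearMap.toContinuousLinearMap
          ((WL2.linearEquiv ℂ ℂ (fun _ : Bond d (towerP L m (n + 1)) => c₀) :
              BondL2K ℂ d (towerP L m (n + 1)) c₀ W ≃ₗ[ℂ] (Bond d (towerP L m (n + 1)) → W)).toLinearMap ∘ₗ D2 ∘ₗ
            (WL2.linearEquiv ℂ ℂ (fun _ : Bond d (towerP L m (n + 1)) => c₀) :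
              BondL2K ℂ d (towerP L m (n + 1)) c₀ W ≃ₗ[ℂ] (Bond d (towerP L m (n + 1)) → W)).symm.toLinearMap)) * G' = 1 ∧
      -- `Inv′ = (Q_kG′Q_k†)⁻¹`, two-sided
      Inv' * ((LinearMap.toContinuousLinearMap
          ((WL2.linearEquiv ℂ ℂ (fun _ : Bond d m => c₁) : BondL2K ℂ d m c₁ W ≃ₗ[ℂ] (Bond d m → W)).toLinearMap ∘ₗ
            QkW L m n φ U hL αU hα1 hU1 hreg (c₀ := c₀) (c₁ := c₁) ∘ₗ
            (WL2.linearEquiv ℂ ℂ (fun _ : Bond d (towerP L m (n + 1)) => c₀) :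
              BondL2K ℂ d (towerP L m (n + 1)) c₀ W ≃ₗ[ℂ] (Bond d (towerP L m (n + 1)) → W)).symm.toLinearMap)).comp
        (G'.comp (LinearMap.toContinuousLinearMap
          ((WL2.linearEquiv ℂ ℂ (fun _ : Bond d (towerP L m (n + 1)) => c₀) :
              BondL2K ℂ d (towerP L m (n + 1)) c₀ W ≃ₗ[ℂ] (Bond d (towerP L m (n + 1)) → W)).toLinearMap ∘ₗ
            LinearMap.adjoint (QkW L m n φ U hL αU hα1 hU1 hreg (c₀ := c₀) (c₁ := c₁)) ∘ₗ
            (WL2.linearEquiv ℂ ℂ (fun _ : Bond d m => c₁) : BondL2K ℂ d m c₁ W ≃ₗ[ℂ] (Bond d m → W)).symm.toLinearMap)))) = 1 ∧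
      ((LinearMap.toContinuousLinearMap
          ((WL2.linearEquiv ℂ ℂ (fun _ : Bond d m => c₁) : BondL2K ℂ d m c₁ W ≃ₗ[ℂ] (Bond d m → W)).toLinearMap ∘ₗ
            QkW L m n φ U hL αU hα1 hU1 hreg (c₀ := c₀) (c₁ := c₁) ∘ₗ
            (WL2.linearEquiv ℂ ℂ (fun _ : Bond d (towerP L m (n + 1)) => c₀) :
              BondL2K ℂ d (towerP L m (n + 1)) c₀ W ≃ₗ[ℂ] (Bond d (towerP L m (n + 1)) → W)).symm.toLinearMap)).comp
        (G'.comp (LinearMap.toContinuousLinearMap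
          ((WL2.linearEquiv ℂ ℂ (fun _ : Bond d (towerP L m (n + 1)) => c₀) :
              BondL2K ℂ d (towerP L m (n + 1)) c₀ W ≃ₗ[ℂ] (Bond d (towerP L m (n + 1)) → W)).toLinearMap ∘ₗ
            LinearMap.adjoint (QkW L m n φ U hL αU hα1 hU1 hreg (c₀ := c₀) (c₁ := c₁)) ∘ₗ
            (WL2.linearEquiv ℂ ℂ (fun _ : Bond d m => c₁) : BondL2K ℂ d m c₁ W ≃ₗ[ℂ] (Bond d m → W)).symm.toLinearMap)))) * Inv' = 1 ∧
      -- the (190) letter of `H₀ + G̃Δ⁽²⁾H₀`, `H₀ = H₁,k(U)` by name, `G̃ = G′ − G′Q_k†·Inv′·Q_kG′`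
      ∀ δ' : ℝ, δ' / 8 ≤ ρ →
        Ineq190
          (supSize (toB6 (torusGeom m η₀ L₀ M₀) R H)
            (fun y => Finset.univ.filter fun c : Bond d m => bpos c = UT.toSite m y)
            (fun c => UT.ofSite m (bpos c)) : BlockNorm (toB6 (torusGeom m η₀ L₀ M₀) R H) (Bond d m → W))
          (supSize (toB6 (torusGeom m η₀ L₀ M₀) R H)
            (fun y => Finset.univ.filter fun x : TSite d (towerP L m (n + 1)) =>
              blockCoord (L ^ (n + 1)) m (siteCast (towerP_eq_fineP_pow L m (n + 1)) x) = UT.toSite m y)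
            (fun x => UT.ofSite m (blockCoord (L ^ (n + 1)) m (siteCast (towerP_eq_fineP_pow L m (n + 1)) x))) :
              BlockNorm (toB6 (torusGeom m η₀ L₀ M₀) R H) (TSite d (towerP L m (n + 1)) → W))
          ((((WL2.linearEquiv ℂ ℂ (fun _ : TSite d (towerP L m (n + 1)) => c₀) :
                SiteL2K ℂ d (towerP L m (n + 1)) c₀ W ≃ₗ[ℂ] (TSite d (towerP L m (n + 1)) → W)).toLinearMap ∘ₗ
              covDivL2K ℂ c₀ ((η : ℂ))⁻¹ (adTransportW φ fun bb => (U bb)⁻¹) ∘ₗ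
              (WL2.linearEquiv ℂ ℂ (fun _ : Bond d (towerP L m (n + 1)) => c₀) :
                BondL2K ℂ d (towerP L m (n + 1)) c₀ W ≃ₗ[ℂ] (Bond d (towerP L m (n + 1)) → W)).symm.toLinearMap).restrictScalars ℝ) ∘ₗ
          ((((WL2.linearEquiv ℂ ℂ (fun _ : Bond d (towerP L m (n + 1)) => c₀) :
                  BondL2K ℂ d (towerP L m (n + 1)) c₀ W ≃ₗ[ℂ] (Bond d (towerP L m (n + 1)) → W)).toLinearMap ∘ₗ
              H1k L m n φ η U hL αU hα1 hU1 hreg τ (c₀ := c₀) (c₁ := c₁) hαL hpos ∘ₗ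
              (WL2.linearEquiv ℂ ℂ (fun _ : Bond d m => c₁) : BondL2K ℂ d m c₁ W ≃ₗ[ℂ] (Bond d m → W)).symm.toLinearMap).restrictScalars ℝ) +
            ((G'.restrictScalars ℝ : (Bond d (towerP L m (n + 1)) → W) →ₗ[ℝ] (Bond d (towerP L m (n + 1)) → W)) -
              ((G'.restrictScalars ℝ : (Bond d (towerP L m (n + 1)) → W) →ₗ[ℝ] (Bond d (towerP L m (n + 1)) → W)) ∘ₗ
                (((WL2.linearEquiv ℂ ℂ (fun _ : Bond d (towerP L m (n + 1)) => c₀) :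
                      BondL2K ℂ d (towerP L m (n + 1)) c₀ W ≃ₗ[ℂ] (Bond d (towerP L m (n + 1)) → W)).toLinearMap ∘ₗ
                  LinearMap.adjoint (QkW L m n φ U hL αU hα1 hU1 hreg (c₀ := c₀) (c₁ := c₁)) ∘ₗ
                  (WL2.linearEquiv ℂ ℂ (fun _ : Bond d m => c₁) : BondL2K ℂ d m c₁ W ≃ₗ[ℂ] (Bond d m → W)).symm.toLinearMap).restrictScalars ℝ)) ∘ₗ
              (Inv'.restrictScalars ℝ : (Bond d m → W) →ₗ[ℝ] (Bond d m → W)) ∘ₗ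
              ((((WL2.linearEquiv ℂ ℂ (fun _ : Bond d m => c₁) : BondL2K ℂ d m c₁ W ≃ₗ[ℂ] (Bond d m → W)).toLinearMap ∘ₗ
                  QkW L m n φ U hL αU hα1 hU1 hreg (c₀ := c₀) (c₁ := c₁) ∘ₗ
                  (WL2.linearEquiv ℂ ℂ (fun _ : Bond d (towerP L m (n + 1)) => c₀) :
                    BondL2K ℂ d (towerP L m (n + 1)) c₀ W ≃ₗ[ℂ] (Bond d (towerP L m (n + 1)) → W)).symm.toLinearMap).restrictScalars ℝ) ∘ₗ
                (G'.restrictScalars ℝ : (Bond d (towerP L m (n + 1)) → W) →ₗ[ℝ] (Bond d (towerP L m (n + 1)) → W)))) ∘ₗ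
            ((((WL2.linearEquiv ℂ ℂ (fun _ : Bond d (towerP L m (n + 1)) => c₀) :
                    BondL2K ℂ d (towerP L m (n + 1)) c₀ W ≃ₗ[ℂ] (Bond d (towerP L m (n + 1)) → W)).toLinearMap ∘ₗ D2 ∘ₗ
                (WL2.linearEquiv ℂ ℂ (fun _ : Bond d (towerP L m (n + 1)) => c₀) :
                  BondL2K ℂ d (towerP L m (n + 1)) c₀ W ≃ₗ[ℂ] (Bond d (towerP L m (n + 1)) → W)).symm.toLinearMap).restrictScalars ℝ) ∘ₗ
              (((WL2.linearEquiv ℂ ℂ (fun _ : Bond d (towerP L m (n + 1)) => c₀) :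
                    BondL2K ℂ d (towerP L m (n + 1)) c₀ W ≃ₗ[ℂ] (Bond d (towerP L m (n + 1)) → W)).toLinearMap ∘ₗ
                H1k L m n φ η U hL αU hα1 hU1 hreg τ (c₀ := c₀) (c₁ := c₁) hαL hpos ∘ₗ
                (WL2.linearEquiv ℂ ℂ (fun _ : Bond d m => c₁) : BondL2K ℂ d m c₁ W ≃ₗ[ℂ] (Bond d m → W)).symm.toLinearMap).restrictScalars ℝ))))
          (A₀E + BEt * θD * c) δ' := by
  obtain ⟨αs, B, δ, BE, A', r₁, hαs, hB, hδ, hBE, hA', hr₁, HY⟩ := exists_ineq190_div_origin_tower_plaquette hd L hL hL3 φ hMφ hMφ' hφ hφ' ha ha' τ hτ hCτ hτm hMτ hρw hτ₁ hτ₂ hφτ AQ hAQ16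
  refine ⟨αs, B, δ, BE, A', r₁, hαs, hB, hδ, hBE, hA', hr₁, ?_⟩
  intro n η hηL c₀ c₁ _ _ hw hρ m _ hm U hUu α hα hαle hUη hpl hUgrad αU hα1 hαL hU1 hreg hpos η₀ L₀ M₀ R H ρ σ c hσ hρ0 hρ₁ hρI hc_def D2 KD
    lam rD hlam hKD hDloc hDrow hDcol hD2 q BG' θP qI BI' A₀ θD A₀E BEG' BEt hq_def hq hBG' hθP hqI hqI1 hBI' hA₀ hθD hA₀E hBEG' hBEt
  obtain ⟨αU', hα1', hαL', hU1', hreg', hpos', h⟩ := HY n η hηL c₀ c₁ hw hρ m hm U hUu α hα hαle hUη hpl hUgrad η₀ L₀ M₀ R H ρ σ c hσ hρ0 hρ₁ hρI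
    hc_def D2 hlam hKD hDloc hDrow hDcol hD2 hq_def hq hBG' hθP hqI hqI1 hBI' hA₀ hθD hA₀E hBEG' hBEt
  rw [H1k_display_irrel L m n φ η U hL αU' αU hα1' hα1 hU1' hU1 hreg' hreg τ hαL' hαL hpos' hpos,
    laplaceAk_display_irrel L m n φ η U hL αU' αU hα1' hα1 hU1' hU1 hreg' hreg τ a,
    QkW_display_irrel L m n φ U hL αU' αU hα1' hα1 hU1' hU1 hreg' hreg (c₀ := c₀) (c₁ := c₁)] at h
  exact h

end Tower

end Literature.MathematicalPhysics.QuantumFieldTheory.Balaban1983to89.Beta.RemainderOriginTowerDivPlaquetteAnyDisplay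

end
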